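import Summits.BirchSwinnertonDyer.BirchSwinnertonDyer.Theorems.ByReductionTypeAtTwoFineSelmerConjAAtTwoAdditivePotGoodClassNumberOddCriterion
import Summits.BirchSwinnertonDyer.BirchSwinnertonDyer.Theorems.ByReductionTypeAtTwoFineSelmerConjAAtTwoAdditivePotGoodClassNumberOne780
import HarnessLib

/-!
# Route `ByReductionTypeAtTwo` (rung K4), crux `SupersingularRankZeroAtTwo` (item stmt-BirchSwinnertonDyer-19097), v2.12 (α) `FineMuZeroOnHabitatAtTwo`:
# KERNEL CLASS-NUMBER CERTIFICATES for the `2`-division cubic fields `L_W` of the good-supersingular rows (tranche of hand h12) —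
# `h(L_W)` ODD by norm witnesses below the Minkowski bound, CHECKED BY THE KERNEL, for the 5 fields `d ∈ {564, −716, −748, 756, −812}`
# (a `--supports 19097` toolkit file, one of two parts; seat `bsd-2adic-t42` GEN 43, hand h12 (3) «kernel parity upgrades where cheap»; consumer `…GoodSSRowKernelStamps`)

HONEST LABEL (cell `bsd-2adic`, D-0036/D-0054): UNCONDITIONAL kernel arithmetic about cubic number fields; closes nothing; nothing booked; BSD is proved
for no curve. PURPOSE: the displayed bit «`2 ∤ h(L_W)`» of the row stamps `…GoodSSRowStampsA/B/C` becomes a KERNEL bit for every row whose field is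
certified here (via `AddKatoTwo.conjA_two_goodSSModel_of_generator`), so those rows hold modulo Lim 2017 Thm. 3.5 ALONE.

THE CERTIFICATES (k4-w1 GEN 6 criterion `odd_classNumber_of_cubeCertificate` + `pow_three_eq_span_of_cert`, `Or.inl` = principal witness): each field is
monogenic for PARI's `polredabs` generator `θ` (index `1`, kit j343820), `|d_K| ≤ |disc|` (`…CubicDiscriminant`), `M_K < B` (`…ExplicitMinkowski`), and for every
prime `ℓ < B` and every root `a` of the cubic mod `ℓ` an element `x + yθ + zθ²` with `ℓ ∣ x + ya + za²` and norm `±ℓ` generates the ideal `(ℓ, θ − a)`; found by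
exact integer search (k4w3 GEN 12 tool `cubiccert.class_cert`, reused verbatim; cell memo `t42/D84-ROWS-GEN43.md`) and checked here by `norm_num`.
Per field: `irreducible_cubic_twoDivField_d…` (no root mod a small prime), `odd_classNumber_of_root_twoDivField_d…`, `not_two_dvd_card_classGroup_twoDivField_d…`.

References: [Marcus1977] Ch. 5 Thm. 35–37, Cor. 2; [Cohen1993] §6.3, App. B; kit j343820 (PARI: all 5 fields `h = 1`, `bnfcertify = 1`).
-/

set_option autoImplicit false
-- sibling precedent (`…ClassNumberOddCriterion.lean`): the directory name repeats the summit name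
set_option linter.dupNamespace false

noncomputable section

open scoped Classical IntermediateField NumberField Real nonZeroDivisors

namespace Summit.BirchSwinnertonDyer.BirchSwinnertonDyer.Theorems.AddKatoTwo

open Polynomial IsDedekindDomain NumberField

section Certificates

variable (K : Type) [Field K] [NumberField K]

/-! ### The totally real cubic field of discriminant `564`: `X³ − X² − 5X + 3` (index `1`, `h = 1`; rows `141e1`) -/

/-- `X³ − X² − 5X + 3` is irreducible over `ℚ` (no root mod `5`). -/
theorem irreducible_cubic_twoDivField_d564p : Irreducible (Cubic.toPoly ⟨1, ((-1 : ℤ) : ℚ), ((-5 : ℤ) : ℚ), ((3 : ℤ) : ℚ)⟩) :=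
  haveI : Fact (Nat.Prime 5) := ⟨by norm_num⟩
  irreducible_cubic_of_no_root_zmod 5 (by decide)

/-- **`h` is ODD (indeed `1`) for every cubic number field whose integers contain a root `θ` of `X³ − X² − 5X + 3`** (`|disc| = 564` = `|d|`, index `1`,
`M_K < 7`): a norm certificate — for every prime `ℓ < 7` and every root `a` of the cubic mod `ℓ` a generator `x + yθ + zθ² ∈ ℤ[θ]` of norm `±ℓ`
of the ideal `I ∋ ℓ, θ − a` of norm `ℓ` (`ℓ = 2`: `a = 1` ↦ `(-1) + (1)θ + (0)θ²`; `ℓ = 3`: `a = 0` ↦ `(0) + (-1)θ + (0)θ²`, `a = 2` ↦ `(-2) + (1)θ + (0)θ²`; `ℓ = 5`: no root); found by exact search (k4w3's `cubiccert.class_cert`) and CHECKED HERE by the kernel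
(`pow_three_eq_span_of_cert`, `Or.inl`). PARI (kit j343820, `bnfcertify = 1`): `h = 1`. KERNEL. [cite: Marcus1977, Ch. 5 Thm. 35–37 and Cor. 2] [cite: Cohen1993, §6.3] -/
theorem odd_classNumber_of_root_twoDivField_d564p (h3 : Module.finrank ℚ K = 3) (b : 𝓞 K)
    (hb : b ^ 3 + (-1 : ℤ) * b ^ 2 + (-5 : ℤ) * b + (3 : ℤ) = 0) : Odd (NumberField.classNumber K) := by
  have hirr := irreducible_cubic_twoDivField_d564p
  have hd : |NumberField.discr K| ≤ (564 : ℕ) :=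
    (abs_discr_le_abs_cubic_discr K h3 b hirr hb).trans (by simp only [Cubic.discr]; norm_num)
  refine odd_classNumber_of_cubeCertificate K h3 (B := 7)
    (minkowskiBound_lt_of_sqrt_le K h3 hd (s := 23.75)
      ((Real.sqrt_le_sqrt (by norm_num : ((564 : ℕ) : ℝ) ≤ (23.75 : ℝ) ^ 2)).trans (Real.sqrt_sq (by norm_num)).le)
      (by norm_num)) ?_
  intro ℓ hℓB hℓ J hJ
  interval_cases ℓ <;> norm_num at hℓ
  · -- `ℓ = 2`: roots [1]
    refine pow_three_eq_span_of_cert K h3 b hirr hb (by norm_num) (fun a ha hdvd => ?_) hJ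
    interval_cases a <;> norm_num at hdvd
    · exact Or.inl ⟨(-1), (1), (0), 1, by norm_num, by norm_num, ⟨_, by rw [Nat.cast_one, one_mul]⟩, by norm_num⟩
  · -- `ℓ = 3`: roots [0, 2]
    refine pow_three_eq_span_of_cert K h3 b hirr hb (by norm_num) (fun a ha hdvd => ?_) hJ
    interval_cases a <;> norm_num at hdvd
    · exact Or.inl ⟨(0), (-1), (0), 1, by norm_num, by norm_num, ⟨_, by rw [Nat.cast_one, one_mul]⟩, by norm_num⟩
    · exact Or.inl ⟨(-2), (1), (0), 1, by norm_num, by norm_num, ⟨_, by rw [Nat.cast_one, one_mul]⟩, by norm_num⟩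
  · -- `ℓ = 5`: roots []
    refine pow_three_eq_span_of_cert K h3 b hirr hb (by norm_num) (fun a ha hdvd => ?_) hJ
    interval_cases a <;> norm_num at hdvd

/-- `2 ∤ #Cl(𝓞 ℚ(θ))` for every root `θ ∈ ℚ̄` of `X³ − X² − 5X + 3` (`d = 564`), by the kernel certificate above. [folklore] -/
theorem not_two_dvd_card_classGroup_twoDivField_d564p {θ : AlgebraicClosure ℚ}
    (hθ : aeval θ (Cubic.toPoly ⟨1, ((-1 : ℤ) : ℚ), ((-5 : ℤ) : ℚ), ((3 : ℤ) : ℚ)⟩) = 0) :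
    ¬ 2 ∣ Nat.card (ClassGroup (𝓞 (IntermediateField.adjoin ℚ {θ}))) :=
  not_two_dvd_card_classGroup_adjoin_of_forall_cubicField_odd irreducible_cubic_twoDivField_d564p
    (odd_classNumber_of_root_twoDivField_d564p) hθ

/-! ### The complex cubic field of discriminant `−716`: `X³ − 4X − 6` (index `1`, `h = 1`; rows `179a1`) -/

/-- `X³ − 4X − 6` is irreducible over `ℚ` (no root mod `5`). -/
theorem irreducible_cubic_twoDivField_d716n : Irreducible (Cubic.toPoly ⟨1, ((0 : ℤ) : ℚ), ((-4 : ℤ) : ℚ), ((-6 : ℤ) : ℚ)⟩) :=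
  haveI : Fact (Nat.Prime 5) := ⟨by norm_num⟩
  irreducible_cubic_of_no_root_zmod 5 (by decide)

/-- **`h` is ODD (indeed `1`) for every cubic number field whose integers contain a root `θ` of `X³ − 4X − 6`** (`|disc| = 716` = `|d|`, index `1`,
`M_K < 8`): a norm certificate — for every prime `ℓ < 8` and every root `a` of the cubic mod `ℓ` a generator `x + yθ + zθ² ∈ ℤ[θ]` of norm `±ℓ`
of the ideal `I ∋ ℓ, θ − a` of norm `ℓ` (`ℓ = 2`: `a = 0` ↦ `(-4) + (-1)θ + (1)θ²`; `ℓ = 3`: `a = 0` ↦ `(-3) + (-3)θ + (-1)θ²`, `a = 1` ↦ `(-5) + (-5)θ + (-2)θ²`, `a = 2` ↦ `(-1) + (-1)θ + (0)θ²`; `ℓ = 5`: no root; `ℓ = 7`: `a = 4` ↦ `(-1) + (-2)θ + (1)θ²`); found by exact search (k4w3's `cubiccert.class_cert`) and CHECKED HERE by the kernel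
(`pow_three_eq_span_of_cert`, `Or.inl`). PARI (kit j343820, `bnfcertify = 1`): `h = 1`. KERNEL. [cite: Marcus1977, Ch. 5 Thm. 35–37 and Cor. 2] [cite: Cohen1993, §6.3] -/
theorem odd_classNumber_of_root_twoDivField_d716n (h3 : Module.finrank ℚ K = 3) (b : 𝓞 K)
    (hb : b ^ 3 + (0 : ℤ) * b ^ 2 + (-4 : ℤ) * b + (-6 : ℤ) = 0) : Odd (NumberField.classNumber K) := by
  have hirr := irreducible_cubic_twoDivField_d716n
  have hd : |NumberField.discr K| ≤ (716 : ℕ) :=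
    (abs_discr_le_abs_cubic_discr K h3 b hirr hb).trans (by simp only [Cubic.discr]; norm_num)
  refine odd_classNumber_of_cubeCertificate K h3 (B := 8)
    (minkowskiBound_lt_of_sqrt_le K h3 hd (s := 26.76)
      ((Real.sqrt_le_sqrt (by norm_num : ((716 : ℕ) : ℝ) ≤ (26.76 : ℝ) ^ 2)).trans (Real.sqrt_sq (by norm_num)).le)
      (by norm_num)) ?_
  intro ℓ hℓB hℓ J hJ
  interval_cases ℓ <;> norm_num at hℓ
  · -- `ℓ = 2`: roots [0]
    refine pow_three_eq_span_of_cert K h3 b hirr hb (by norm_num) (fun a ha hdvd => ?_) hJ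
    interval_cases a <;> norm_num at hdvd
    · exact Or.inl ⟨(-4), (-1), (1), 1, by norm_num, by norm_num, ⟨_, by rw [Nat.cast_one, one_mul]⟩, by norm_num⟩
  · -- `ℓ = 3`: roots [0, 1, 2]
    refine pow_three_eq_span_of_cert K h3 b hirr hb (by norm_num) (fun a ha hdvd => ?_) hJ
    interval_cases a <;> norm_num at hdvd
    · exact Or.inl ⟨(-3), (-3), (-1), 1, by norm_num, by norm_num, ⟨_, by rw [Nat.cast_one, one_mul]⟩, by norm_num⟩
    · exact Or.inl ⟨(-5), (-5), (-2), 1, by norm_num, by norm_num, ⟨_, by rw [Nat.cast_one, one_mul]⟩, by norm_num⟩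
    · exact Or.inl ⟨(-1), (-1), (0), 1, by norm_num, by norm_num, ⟨_, by rw [Nat.cast_one, one_mul]⟩, by norm_num⟩
  · -- `ℓ = 5`: roots []
    refine pow_three_eq_span_of_cert K h3 b hirr hb (by norm_num) (fun a ha hdvd => ?_) hJ
    interval_cases a <;> norm_num at hdvd
  · -- `ℓ = 7`: roots [4]
    refine pow_three_eq_span_of_cert K h3 b hirr hb (by norm_num) (fun a ha hdvd => ?_) hJ
    interval_cases a <;> norm_num at hdvd
    · exact Or.inl ⟨(-1), (-2), (1), 1, by norm_num, by norm_num, ⟨_, by rw [Nat.cast_one, one_mul]⟩, by norm_num⟩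

/-- `2 ∤ #Cl(𝓞 ℚ(θ))` for every root `θ ∈ ℚ̄` of `X³ − 4X − 6` (`d = −716`), by the kernel certificate above. [folklore] -/
theorem not_two_dvd_card_classGroup_twoDivField_d716n {θ : AlgebraicClosure ℚ}
    (hθ : aeval θ (Cubic.toPoly ⟨1, ((0 : ℤ) : ℚ), ((-4 : ℤ) : ℚ), ((-6 : ℤ) : ℚ)⟩) = 0) :
    ¬ 2 ∣ Nat.card (ClassGroup (𝓞 (IntermediateField.adjoin ℚ {θ}))) :=
  not_two_dvd_card_classGroup_adjoin_of_forall_cubicField_odd irreducible_cubic_twoDivField_d716n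
    (odd_classNumber_of_root_twoDivField_d716n) hθ

/-! ### The complex cubic field of discriminant `−748`: `X³ − X² + X + 5` (index `1`, `h = 1`; rows `187b1`) -/

/-- `X³ − X² + X + 5` is irreducible over `ℚ` (no root mod `7`). -/
theorem irreducible_cubic_twoDivField_d748n : Irreducible (Cubic.toPoly ⟨1, ((-1 : ℤ) : ℚ), ((1 : ℤ) : ℚ), ((5 : ℤ) : ℚ)⟩) :=
  haveI : Fact (Nat.Prime 7) := ⟨by norm_num⟩
  irreducible_cubic_of_no_root_zmod 7 (by decide)

/-- **`h` is ODD (indeed `1`) for every cubic number field whose integers contain a root `θ` of `X³ − X² + X + 5`** (`|disc| = 748` = `|d|`, index `1`,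
`M_K < 8`): a norm certificate — for every prime `ℓ < 8` and every root `a` of the cubic mod `ℓ` a generator `x + yθ + zθ² ∈ ℤ[θ]` of norm `±ℓ`
of the ideal `I ∋ ℓ, θ − a` of norm `ℓ` (`ℓ = 2`: `a = 1` ↦ `(-1) + (-1)θ + (0)θ²`; `ℓ = 3`: `a = 1` ↦ `(-3) + (-1)θ + (1)θ²`; `ℓ = 5`: `a = 0` ↦ `(0) + (-1)θ + (0)θ²`; `ℓ = 7`: no root); found by exact search (k4w3's `cubiccert.class_cert`) and CHECKED HERE by the kernel
(`pow_three_eq_span_of_cert`, `Or.inl`). PARI (kit j343820, `bnfcertify = 1`): `h = 1`. KERNEL. [cite: Marcus1977, Ch. 5 Thm. 35–37 and Cor. 2] [cite: Cohen1993, §6.3] -/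
theorem odd_classNumber_of_root_twoDivField_d748n (h3 : Module.finrank ℚ K = 3) (b : 𝓞 K)
    (hb : b ^ 3 + (-1 : ℤ) * b ^ 2 + (1 : ℤ) * b + (5 : ℤ) = 0) : Odd (NumberField.classNumber K) := by
  have hirr := irreducible_cubic_twoDivField_d748n
  have hd : |NumberField.discr K| ≤ (748 : ℕ) :=
    (abs_discr_le_abs_cubic_discr K h3 b hirr hb).trans (by simp only [Cubic.discr]; norm_num)
  refine odd_classNumber_of_cubeCertificate K h3 (B := 8)
    (minkowskiBound_lt_of_sqrt_le K h3 hd (s := 27.35)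
      ((Real.sqrt_le_sqrt (by norm_num : ((748 : ℕ) : ℝ) ≤ (27.35 : ℝ) ^ 2)).trans (Real.sqrt_sq (by norm_num)).le)
      (by norm_num)) ?_
  intro ℓ hℓB hℓ J hJ
  interval_cases ℓ <;> norm_num at hℓ
  · -- `ℓ = 2`: roots [1]
    refine pow_three_eq_span_of_cert K h3 b hirr hb (by norm_num) (fun a ha hdvd => ?_) hJ
    interval_cases a <;> norm_num at hdvd
    · exact Or.inl ⟨(-1), (-1), (0), 1, by norm_num, by norm_num, ⟨_, by rw [Nat.cast_one, one_mul]⟩, by norm_num⟩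
  · -- `ℓ = 3`: roots [1]
    refine pow_three_eq_span_of_cert K h3 b hirr hb (by norm_num) (fun a ha hdvd => ?_) hJ
    interval_cases a <;> norm_num at hdvd
    · exact Or.inl ⟨(-3), (-1), (1), 1, by norm_num, by norm_num, ⟨_, by rw [Nat.cast_one, one_mul]⟩, by norm_num⟩
  · -- `ℓ = 5`: roots [0]
    refine pow_three_eq_span_of_cert K h3 b hirr hb (by norm_num) (fun a ha hdvd => ?_) hJ
    interval_cases a <;> norm_num at hdvd
    · exact Or.inl ⟨(0), (-1), (0), 1, by norm_num, by norm_num, ⟨_, by rw [Nat.cast_one, one_mul]⟩, by norm_num⟩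
  · -- `ℓ = 7`: roots []
    refine pow_three_eq_span_of_cert K h3 b hirr hb (by norm_num) (fun a ha hdvd => ?_) hJ
    interval_cases a <;> norm_num at hdvd

/-- `2 ∤ #Cl(𝓞 ℚ(θ))` for every root `θ ∈ ℚ̄` of `X³ − X² + X + 5` (`d = −748`), by the kernel certificate above. [folklore] -/
theorem not_two_dvd_card_classGroup_twoDivField_d748n {θ : AlgebraicClosure ℚ}
    (hθ : aeval θ (Cubic.toPoly ⟨1, ((-1 : ℤ) : ℚ), ((1 : ℤ) : ℚ), ((5 : ℤ) : ℚ)⟩) = 0) :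
    ¬ 2 ∣ Nat.card (ClassGroup (𝓞 (IntermediateField.adjoin ℚ {θ}))) :=
  not_two_dvd_card_classGroup_adjoin_of_forall_cubicField_odd irreducible_cubic_twoDivField_d748n
    (odd_classNumber_of_root_twoDivField_d748n) hθ

/-! ### The totally real cubic field of discriminant `756`: `X³ − 6X − 2` (index `1`, `h = 1`; rows `189c1`, `189d1`) -/

/-- `X³ − 6X − 2` is irreducible over `ℚ` (no root mod `5`). -/
theorem irreducible_cubic_twoDivField_d756p : Irreducible (Cubic.toPoly ⟨1, ((0 : ℤ) : ℚ), ((-6 : ℤ) : ℚ), ((-2 : ℤ) : ℚ)⟩) :=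
  haveI : Fact (Nat.Prime 5) := ⟨by norm_num⟩
  irreducible_cubic_of_no_root_zmod 5 (by decide)

/-- **`h` is ODD (indeed `1`) for every cubic number field whose integers contain a root `θ` of `X³ − 6X − 2`** (`|disc| = 756` = `|d|`, index `1`,
`M_K < 8`): a norm certificate — for every prime `ℓ < 8` and every root `a` of the cubic mod `ℓ` a generator `x + yθ + zθ² ∈ ℤ[θ]` of norm `±ℓ`
of the ideal `I ∋ ℓ, θ − a` of norm `ℓ` (`ℓ = 2`: `a = 0` ↦ `(0) + (-1)θ + (0)θ²`; `ℓ = 3`: `a = 2` ↦ `(-1) + (-1)θ + (0)θ²`; `ℓ = 5`: no root; `ℓ = 7`: `a = 1` ↦ `(-1) + (1)θ + (0)θ²`, `a = 3` ↦ `(-1) + (-2)θ + (0)θ²`); found by exact search (k4w3's `cubiccert.class_cert`) and CHECKED HERE by the kernel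
(`pow_three_eq_span_of_cert`, `Or.inl`). PARI (kit j343820, `bnfcertify = 1`): `h = 1`. KERNEL. [cite: Marcus1977, Ch. 5 Thm. 35–37 and Cor. 2] [cite: Cohen1993, §6.3] -/
theorem odd_classNumber_of_root_twoDivField_d756p (h3 : Module.finrank ℚ K = 3) (b : 𝓞 K)
    (hb : b ^ 3 + (0 : ℤ) * b ^ 2 + (-6 : ℤ) * b + (-2 : ℤ) = 0) : Odd (NumberField.classNumber K) := by
  have hirr := irreducible_cubic_twoDivField_d756p
  have hd : |NumberField.discr K| ≤ (756 : ℕ) :=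
    (abs_discr_le_abs_cubic_discr K h3 b hirr hb).trans (by simp only [Cubic.discr]; norm_num)
  refine odd_classNumber_of_cubeCertificate K h3 (B := 8)
    (minkowskiBound_lt_of_sqrt_le K h3 hd (s := 27.50)
      ((Real.sqrt_le_sqrt (by norm_num : ((756 : ℕ) : ℝ) ≤ (27.50 : ℝ) ^ 2)).trans (Real.sqrt_sq (by norm_num)).le)
      (by norm_num)) ?_
  intro ℓ hℓB hℓ J hJ
  interval_cases ℓ <;> norm_num at hℓ
  · -- `ℓ = 2`: roots [0]
    refine pow_three_eq_span_of_cert K h3 b hirr hb (by norm_num) (fun a ha hdvd => ?_) hJ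
    interval_cases a <;> norm_num at hdvd
    · exact Or.inl ⟨(0), (-1), (0), 1, by norm_num, by norm_num, ⟨_, by rw [Nat.cast_one, one_mul]⟩, by norm_num⟩
  · -- `ℓ = 3`: roots [2]
    refine pow_three_eq_span_of_cert K h3 b hirr hb (by norm_num) (fun a ha hdvd => ?_) hJ
    interval_cases a <;> norm_num at hdvd
    · exact Or.inl ⟨(-1), (-1), (0), 1, by norm_num, by norm_num, ⟨_, by rw [Nat.cast_one, one_mul]⟩, by norm_num⟩
  · -- `ℓ = 5`: roots []
    refine pow_three_eq_span_of_cert K h3 b hirr hb (by norm_num) (fun a ha hdvd => ?_) hJ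
    interval_cases a <;> norm_num at hdvd
  · -- `ℓ = 7`: roots [1, 3]
    refine pow_three_eq_span_of_cert K h3 b hirr hb (by norm_num) (fun a ha hdvd => ?_) hJ
    interval_cases a <;> norm_num at hdvd
    · exact Or.inl ⟨(-1), (1), (0), 1, by norm_num, by norm_num, ⟨_, by rw [Nat.cast_one, one_mul]⟩, by norm_num⟩
    · exact Or.inl ⟨(-1), (-2), (0), 1, by norm_num, by norm_num, ⟨_, by rw [Nat.cast_one, one_mul]⟩, by norm_num⟩

/-- `2 ∤ #Cl(𝓞 ℚ(θ))` for every root `θ ∈ ℚ̄` of `X³ − 6X − 2` (`d = 756`), by the kernel certificate above. [folklore] -/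
theorem not_two_dvd_card_classGroup_twoDivField_d756p {θ : AlgebraicClosure ℚ}
    (hθ : aeval θ (Cubic.toPoly ⟨1, ((0 : ℤ) : ℚ), ((-6 : ℤ) : ℚ), ((-2 : ℤ) : ℚ)⟩) = 0) :
    ¬ 2 ∣ Nat.card (ClassGroup (𝓞 (IntermediateField.adjoin ℚ {θ}))) :=
  not_two_dvd_card_classGroup_adjoin_of_forall_cubicField_odd irreducible_cubic_twoDivField_d756p
    (odd_classNumber_of_root_twoDivField_d756p) hθ

/-! ### The complex cubic field of discriminant `−812`: `X³ − X² − 7X − 7` (index `1`, `h = 1`; rows `203a1`) -/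

/-- `X³ − X² − 7X − 7` is irreducible over `ℚ` (no root mod `3`). -/
theorem irreducible_cubic_twoDivField_d812n : Irreducible (Cubic.toPoly ⟨1, ((-1 : ℤ) : ℚ), ((-7 : ℤ) : ℚ), ((-7 : ℤ) : ℚ)⟩) :=
  haveI : Fact (Nat.Prime 3) := ⟨by norm_num⟩
  irreducible_cubic_of_no_root_zmod 3 (by decide)

/-- **`h` is ODD (indeed `1`) for every cubic number field whose integers contain a root `θ` of `X³ − X² − 7X − 7`** (`|disc| = 812` = `|d|`, index `1`,
`M_K < 9`): a norm certificate — for every prime `ℓ < 9` and every root `a` of the cubic mod `ℓ` a generator `x + yθ + zθ² ∈ ℤ[θ]` of norm `±ℓ`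
of the ideal `I ∋ ℓ, θ − a` of norm `ℓ` (`ℓ = 2`: `a = 1` ↦ `(-1) + (-1)θ + (0)θ²`; `ℓ = 3`: no root; `ℓ = 5`: `a = 3` ↦ `(-2) + (-1)θ + (0)θ²`; `ℓ = 7`: `a = 0` ↦ `(0) + (-1)θ + (0)θ²`, `a = 1` ↦ `(-3) + (-3)θ + (-1)θ²`); found by exact search (k4w3's `cubiccert.class_cert`) and CHECKED HERE by the kernel
(`pow_three_eq_span_of_cert`, `Or.inl`). PARI (kit j343820, `bnfcertify = 1`): `h = 1`. KERNEL. [cite: Marcus1977, Ch. 5 Thm. 35–37 and Cor. 2] [cite: Cohen1993, §6.3] -/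
theorem odd_classNumber_of_root_twoDivField_d812n (h3 : Module.finrank ℚ K = 3) (b : 𝓞 K)
    (hb : b ^ 3 + (-1 : ℤ) * b ^ 2 + (-7 : ℤ) * b + (-7 : ℤ) = 0) : Odd (NumberField.classNumber K) := by
  have hirr := irreducible_cubic_twoDivField_d812n
  have hd : |NumberField.discr K| ≤ (812 : ℕ) :=
    (abs_discr_le_abs_cubic_discr K h3 b hirr hb).trans (by simp only [Cubic.discr]; norm_num)
  refine odd_classNumber_of_cubeCertificate K h3 (B := 9)
    (minkowskiBound_lt_of_sqrt_le K h3 hd (s := 28.50)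
      ((Real.sqrt_le_sqrt (by norm_num : ((812 : ℕ) : ℝ) ≤ (28.50 : ℝ) ^ 2)).trans (Real.sqrt_sq (by norm_num)).le)
      (by norm_num)) ?_
  intro ℓ hℓB hℓ J hJ
  interval_cases ℓ <;> norm_num at hℓ
  · -- `ℓ = 2`: roots [1]
    refine pow_three_eq_span_of_cert K h3 b hirr hb (by norm_num) (fun a ha hdvd => ?_) hJ
    interval_cases a <;> norm_num at hdvd
    · exact Or.inl ⟨(-1), (-1), (0), 1, by norm_num, by norm_num, ⟨_, by rw [Nat.cast_one, one_mul]⟩, by norm_num⟩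
  · -- `ℓ = 3`: roots []
    refine pow_three_eq_span_of_cert K h3 b hirr hb (by norm_num) (fun a ha hdvd => ?_) hJ
    interval_cases a <;> norm_num at hdvd
  · -- `ℓ = 5`: roots [3]
    refine pow_three_eq_span_of_cert K h3 b hirr hb (by norm_num) (fun a ha hdvd => ?_) hJ
    interval_cases a <;> norm_num at hdvd
    · exact Or.inl ⟨(-2), (-1), (0), 1, by norm_num, by norm_num, ⟨_, by rw [Nat.cast_one, one_mul]⟩, by norm_num⟩
  · -- `ℓ = 7`: roots [0, 1]
    refine pow_three_eq_span_of_cert K h3 b hirr hb (by norm_num) (fun a ha hdvd => ?_) hJ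
    interval_cases a <;> norm_num at hdvd
    · exact Or.inl ⟨(0), (-1), (0), 1, by norm_num, by norm_num, ⟨_, by rw [Nat.cast_one, one_mul]⟩, by norm_num⟩
    · exact Or.inl ⟨(-3), (-3), (-1), 1, by norm_num, by norm_num, ⟨_, by rw [Nat.cast_one, one_mul]⟩, by norm_num⟩

/-- `2 ∤ #Cl(𝓞 ℚ(θ))` for every root `θ ∈ ℚ̄` of `X³ − X² − 7X − 7` (`d = −812`), by the kernel certificate above. [folklore] -/
theorem not_two_dvd_card_classGroup_twoDivField_d812n {θ : AlgebraicClosure ℚ}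
    (hθ : aeval θ (Cubic.toPoly ⟨1, ((-1 : ℤ) : ℚ), ((-7 : ℤ) : ℚ), ((-7 : ℤ) : ℚ)⟩) = 0) :
    ¬ 2 ∣ Nat.card (ClassGroup (𝓞 (IntermediateField.adjoin ℚ {θ}))) :=
  not_two_dvd_card_classGroup_adjoin_of_forall_cubicField_odd irreducible_cubic_twoDivField_d812n
    (odd_classNumber_of_root_twoDivField_d812n) hθ
end Certificates

end Summit.BirchSwinnertonDyer.BirchSwinnertonDyer.Theorems.AddKatoTwo

end
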